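import Mathlib
import Summits.KontsevichZagierPeriods.Zeta5Search.UniversalDigitCells
import Summits.KontsevichZagierPeriods.Zeta5Search.ThirdOrderDigit
import HarnessLib

/-!
# ζ(5) search — STATEMENT FILE: the CENTRE-COMPANION IDENTITY for the first-digit orbit vectors (DENOM-LAW D1, prover-d1 gen 15)

HONEST FRAMING: systematic search; no irrationality claim unless certified.  Cell `pub-zeta5`, track «DENOM-LAW» D1, seat `denom-prover-d1`
gen 15 (`denom-law/prover-d1/ATTEMPT-15.md` §5).  TWO `Prop`s, tagged `@[conjecture]` because they are not proved IN LEAN here; both are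
IDENTITIES BETWEEN EXPLICIT RATIONAL NUMBERS (the orbit digit-vectors `orbitK`, `orbitV` of `UniversalDigitCells`, i.e. the type functionals
`ĉ`, `v̂` of `UniversalDigit`), PROVED ON PAPER (ten lines, below) and checked in exact arithmetic on 4,799 random types (0 failures) and at the
record-ray lattice points where gen-2 g13 had OBSERVED the coincidence instance by instance (`OddDepthWindows.lean` docstring: «(64,101),
(165,101) … the CENTRE class is deep and its point σ(c) COINCIDES with the pair point», «(97,173), (114,167), (227,107): three keys but two
points»).  Nothing here is about ζ(5); no γ; records in print UNMOVED.

THE IDENTITY.  Depth `N` ODD, `N ≥ 3`.  Let `x` be the CENTRE class (`CentreIn b p x`) at exponent `−N` with at least two poles, and `y` a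
centre-free class at exponent `−N` with at least two poles whose type list is the centre class's PALINDROME with ONE NEW END POINT:
* odd `b₀` (`CentreCompanionOdd`): `classTypeList b p x = Tc` with `Tc` a palindrome (the half-integer centre sits at level `L/2` and adds `1`
  to the exponent), and `classTypeList b p y = Tc ++ [1]`;
* even `b₀` (`CentreCompanionEven`): `classTypeList b p x = raiseAtList T₀ (L/2)` with `T₀` a palindrome of odd length `L+1` (the lattice
  centre is the middle point, whose net exponent carries the extra `+1`), and `classTypeList b p y = T₀ ++ [1]`.
Then `orbitK b p N x = orbitK b p N y` and `orbitV b p N x = orbitV b p N y` (so the two orbits contribute ONE point to gen-2 g9's collinearity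
criterion: with one further key the deep orbit points lie on an affine line and `collinearityCriterion_holds` gives `casLB + 1` in the moment
range — the boundary-layer «three keys, two points» instances of the record ray, e.g. (114,167), truth `−66 = casLB + 1`).

PAPER PROOF (ATTEMPT-15 §5).  All three classes have class function `(η − c)·Φ_T` (`T = Tc` resp. `T₀`): `c = L/2` for the centre class
(`SecondOrderCentre.classRho_centre_level`), `c = L+1` for `y` (`SecondOrderRaise.typeRho_snocOne`), and the conjugate `ȳ` (type `[1] ++ T`,
levels shifted by one, `typeRho_consOne`).  For the cofactor data `ρ'_{l,σ} = (l − c)ρ_{l,σ} + ρ_{l,σ+1}` one gets `ĉ' = ĉ₂(T) − c·ĉ(T)` with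
`ĉ₂ := Σ(l³ρ₁ + 3l²ρ₂ + 2lρ₃)` and `v̂' = v̂₂(T) − c·v̂(T)` (`vHat_of_rho_mul`); for `ȳ`: `v̂(ȳ) = v̂₂ + v̂ + R`, where
`R = Σ_{l,σ}(−1)^σ[(l+1)ρ_{l,σ} + ρ_{l,σ+1}](l+1)^{−σ}` (from `H^{(σ)}_{l+1} = H^{(σ)}_l + (l+1)^{−σ}`) telescopes in `σ` to `−Σ_l ρ_{l,1} = 0`, and
`ĉ(ȳ) = ĉ₂ + 3ĉ + 2Σρ₃ + 3Σ(ρ₂ + lρ₁) + Σρ₁ = ĉ₂ + ĉ + 2·[E(T) = −3]` by the three residue identities (`RhoResidueIdentities`; here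
`E(T) = −N−1 ≤ −4`), while `ĉ(T) = 0` for a palindrome of even exponent (reversal identity).  With `N` odd the orbit signs are `+1`, hence
`orbitK(y) = ĉ(y) + ĉ(ȳ) = 2ĉ₂ = 2ĉ(x) = orbitK(x)` and `orbitV(y) = (v̂₂ − (L+1)v̂) + (v̂₂ + v̂) = 2v̂₂ − Lv̂ = 2v̂(x) = orbitV(x)` (the `V`-half is the
tree's `typeV_raise_pair` + `vHat_centre_level`, used one level higher inside `LawA3`).  The residue identities for the UNREALISED list `T` follow
from the realised ones of `x` and `y` (two linear systems with `c ≠ c′`).  LEAN SIZE ESTIMATE ≈ 300 lines (type-level `ĉ`-rules are the new part).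

EVIDENCE (`denom-law/prover-d1/g15/code/centre_identity.py`, exact rationals via gen-2 g9's `udigit.chat_vhat_of`): odd-`b₀` form 2,958/2,958
random palindromes `Tc` (`L ≤ 11`, `N` odd `≥ 3`); even-`b₀` form 1,841/1,841 (`N` odd `≥ 3`); it FAILS for `N ∈ {1, 2}` (the `[E = −3]` term,
`Σρ₁ ≠ 0`) and for `N` even (orbit sign `−1`; not claimed); record-ray instances (143,85), (142,91), (114,167) (`keys3_test.py`).
-/

namespace Summit.KontsevichZagierPeriods.Zeta5Search.DenomLaw

open Summit.KontsevichZagierPeriods.Zeta5Search.CasoratianValuation (InPolytope)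
open Summit.KontsevichZagierPeriods.Zeta5Search.ClusterValuation (classExp classPoleCount CentreIn orbitK orbitV)
open Summit.KontsevichZagierPeriods.Zeta5Search.SecondOrder (classTypeList raiseAtList)

/-- **CENTRE-COMPANION IDENTITY, odd `b₀`** (half-integer centre; OBSERVED/paper-proved, see the module docstring): for `N` odd `≥ 3`, the centre
class `x` of palindromic type list `Tc` and a centre-free class `y` of type list `Tc ++ [1]`, both multipole of exponent `−N`, have the same
first-digit orbit vector: `orbitK x = orbitK y`, `orbitV x = orbitV y`. -/
@[conjecture] def CentreCompanionOdd : Prop :=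
  ∀ (b : ℕ → ℤ) (p N x y : ℕ) (Tc : List ℤ), InPolytope b → p.Prime → 5 ≤ p → (p : ℤ) ≤ b 0 → (b 0 + 2 : ℤ) < (p : ℤ) ^ 2 →
    ¬ (2 : ℤ) ∣ b 0 → 3 ≤ N → ¬ 2 ∣ N → x < p → y < p →
    2 ≤ classPoleCount b p x → CentreIn b p x → classExp b p x = -(N : ℤ) → classTypeList b p x = Tc → Tc.reverse = Tc →
    2 ≤ classPoleCount b p y → ¬ CentreIn b p y → classExp b p y = -(N : ℤ) → classTypeList b p y = Tc ++ [1] →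
      orbitK b p N x = orbitK b p N y ∧ orbitV b p N x = orbitV b p N y

/-- **CENTRE-COMPANION IDENTITY, even `b₀`** (lattice centre = the middle point of a class of odd length `L+1`, its net exponent carrying the
centre's `+1`): for `N` odd `≥ 3`, the centre class `x` with type list `raiseAtList T₀ (L/2)`, `T₀` a palindrome of length `L+1`, `L` even, and a
centre-free class `y` of type list `T₀ ++ [1]`, both multipole of exponent `−N`, have `orbitK x = orbitK y` and `orbitV x = orbitV y`. -/
@[conjecture] def CentreCompanionEven : Prop :=
  ∀ (b : ℕ → ℤ) (p N x y L : ℕ) (T₀ : List ℤ), InPolytope b → p.Prime → 5 ≤ p → (p : ℤ) ≤ b 0 → (b 0 + 2 : ℤ) < (p : ℤ) ^ 2 →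
    (2 : ℤ) ∣ b 0 → 3 ≤ N → ¬ 2 ∣ N → x < p → y < p → 2 ∣ L → T₀.length = L + 1 → T₀.reverse = T₀ →
    2 ≤ classPoleCount b p x → CentreIn b p x → classExp b p x = -(N : ℤ) → classTypeList b p x = raiseAtList T₀ (L / 2) →
    2 ≤ classPoleCount b p y → ¬ CentreIn b p y → classExp b p y = -(N : ℤ) → classTypeList b p y = T₀ ++ [1] →
      orbitK b p N x = orbitK b p N y ∧ orbitV b p N x = orbitV b p N y

/-- Sanity of the list bookkeeping in the even form: the centre list of `T₀ = [1,−6,−6,−5,−6,−6,1]` (`L = 6`) raised at the middle is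
`[1,−6,−6,−4,−6,−6,1]`, and the companion list is `T₀ ++ [1]`. -/
example : raiseAtList [1, -6, -6, -5, -6, -6, 1] (6 / 2) = [1, -6, -6, -4, -6, -6, 1] ∧
    [1, -6, -6, -5, -6, -6, 1] ++ [1] = [1, -6, -6, -5, -6, -6, 1, (1 : ℤ)] := by decide

end Summit.KontsevichZagierPeriods.Zeta5Search.DenomLaw
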